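import Summits.NavierStokesRegularity.NavierStokesRegularity.Theorems.ExtremiserTransienceNearExtremalTransienceExtremiserLiouvilleConstantCarrier
import HarnessLib

/-!
# Crux `ExtremiserTransience.NearExtremalTransience` (stmt-NavierStokesRegularity-21883), line `extremiser_liouville`,
# stub K1b — «NO GAIN FROM CONSTANTS», file 3/5: LOCALITY OF THE DEPLETION DENSITIES, TRANSLATES, THE LATTICE OF CENTRES

`--supports stmt-NavierStokesRegularity-21883` (helper).  Author: prover seat `ns-el-k1b` (g0).

Bookkeeping for the array construction (files 4/5, 5/5): the three depletion densities `σ_f = ⟪curl f, Df curl f⟫`,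
`ζ_f = ‖curl f‖²`, `π_f = |D curl f|²` (`sig`, `zet`, `pal`) depend only on the GERM of `f` (`sig_congr`, …), vanish off
`tsupport f` and for constant fields, commute with translations `f ↦ f(· − c) + b` (`densities_translate`), and are
integrable for `f ∈ C^∞_c` (`integrable_densities`); a `C^∞_c` field is admissible (`admissible_of_compactSupport`); the
lattice points `s·k`, `k ∈ [N]³` are pairwise `≥ s` apart and of norm `≤ 2sN` (`le_norm_centre_sub`, `norm_centre_le`).

WHAT THIS IS NOT: K1b is a STATIC statement about analytic κ⋆-efficient fields; the crux NET, rung N0 and NS regularity stay OPEN — nothing here proves NS regularity. [folklore]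
-/

noncomputable section

open Set Filter Topology MeasureTheory Metric
open scoped InnerProductSpace RealInnerProductSpace ENNReal NNReal ContDiff
open Literature.Analysis.FluidPDE

namespace Summit.NavierStokesRegularity.NavierStokesRegularity.Theorems

-- the problem directory repeats the summit name (`NavierStokesRegularity/NavierStokesRegularity`)
set_option linter.dupNamespace false

namespace ExtremiserLiouville

open DepletionLadder.KStar.HalfSpace (E3)

/-! ## The three depletion densities and their locality -/

/-- Stretching density `σ_f(x) = ⟪curl f, Df curl f⟫(x)`. -/
def sig (f : E3 → E3) (x : E3) : ℝ := ⟪curl f x, fderiv ℝ f x (curl f x)⟫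

/-- Enstrophy density `ζ_f(x) = ‖curl f (x)‖²`. -/
def zet (f : E3 → E3) (x : E3) : ℝ := ‖curl f x‖ ^ 2

/-- Palinstrophy density `π_f(x) = |D curl f (x)|²`. -/
def pal (f : E3 → E3) (x : E3) : ℝ := frobeniusNormSq (fderiv ℝ (curl f) x)

variable {f g : E3 → E3} {x : E3}

/-- Auxiliary (`frobeniusNormSq_zero3`). [folklore] -/
theorem frobeniusNormSq_zero3 : frobeniusNormSq (0 : E3 →L[ℝ] E3) = 0 := by
  unfold frobeniusNormSq; simp

/-- Auxiliary (`continuous_frobeniusNormSq3`). [folklore] -/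
theorem continuous_frobeniusNormSq3 : Continuous fun A : E3 →L[ℝ] E3 => frobeniusNormSq A := by
  unfold frobeniusNormSq
  refine continuous_finsetSum _ fun i _ => ?_
  exact (continuous_eval_const (stdOrthonormalBasis ℝ E3 i)).norm.pow 2

/-- Germs determine `curl`. [folklore] -/
theorem curl_congr_of_eventuallyEq (h : f =ᶠ[𝓝 x] g) : curl f x = curl g x := by
  rw [curl_eq_curlCLM, curl_eq_curlCLM, h.fderiv_eq]

/-- Germs determine the germ of `curl`. [folklore] -/
theorem curl_eventuallyEq (h : f =ᶠ[𝓝 x] g) : curl f =ᶠ[𝓝 x] curl g :=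
  h.eventuallyEq_nhds.mono fun _ hy => curl_congr_of_eventuallyEq hy

/-- Auxiliary (`sig_congr`). [folklore] -/
theorem sig_congr (h : f =ᶠ[𝓝 x] g) : sig f x = sig g x := by
  unfold sig; rw [curl_congr_of_eventuallyEq h, h.fderiv_eq]

/-- Auxiliary (`zet_congr`). [folklore] -/
theorem zet_congr (h : f =ᶠ[𝓝 x] g) : zet f x = zet g x := by
  unfold zet; rw [curl_congr_of_eventuallyEq h]

/-- Auxiliary (`pal_congr`). [folklore] -/
theorem pal_congr (h : f =ᶠ[𝓝 x] g) : pal f x = pal g x := by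
  unfold pal; rw [(curl_eventuallyEq h).fderiv_eq]

/-- Off `tsupport f` all three densities vanish. [folklore] -/
theorem densities_eq_zero_of_notMem (hx : x ∉ tsupport f) : sig f x = 0 ∧ zet f x = 0 ∧ pal f x = 0 := by
  obtain ⟨-, hc, -, hdc⟩ := DepletionLadder.KStar.vanish_of_notMem_tsupport (φ := f) hx
  refine ⟨?_, ?_, ?_⟩
  · unfold sig; rw [hc, inner_zero_left]
  · unfold zet; rw [hc, norm_zero]; ring
  · unfold pal; rw [hdc, frobeniusNormSq_zero3]

/-- The densities of a constant field vanish. [folklore] -/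
theorem densities_const (c x : E3) : sig (fun _ => c) x = 0 ∧ zet (fun _ => c) x = 0 ∧ pal (fun _ => c) x = 0 := by
  have hc : curl (fun _ : E3 => c) = fun _ => 0 := by
    funext y; rw [curl_eq_curlCLM, fderiv_const_apply, map_zero]
  refine ⟨?_, ?_, ?_⟩
  · unfold sig; rw [hc, inner_zero_left]
  · unfold zet; rw [hc, norm_zero]; ring
  · unfold pal; rw [hc, fderiv_const_apply, frobeniusNormSq_zero3]

/-! ## Translates -/

/-- Auxiliary (`fderiv_translate_add_const`). [folklore] -/
theorem fderiv_translate_add_const (u : E3 → E3) (c b x : E3) :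
    fderiv ℝ (fun y => u (y - c) + b) x = fderiv ℝ u (x - c) := by
  rw [fderiv_add_const]
  have h : (fun y => u (y - c)) = fun y => u (y + -c) := funext fun y => by rw [sub_eq_add_neg]
  rw [h, fderiv_comp_add_right, ← sub_eq_add_neg]

/-- Auxiliary (`curl_translate_add_const`). [folklore] -/
theorem curl_translate_add_const (u : E3 → E3) (c b x : E3) :
    curl (fun y => u (y - c) + b) x = curl u (x - c) := by
  rw [curl_eq_curlCLM, curl_eq_curlCLM, fderiv_translate_add_const]

/-- Auxiliary (`fderiv_curl_translate_add_const`). [folklore] -/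
theorem fderiv_curl_translate_add_const (u : E3 → E3) (c b x : E3) :
    fderiv ℝ (curl fun y => u (y - c) + b) x = fderiv ℝ (curl u) (x - c) := by
  have h : (curl fun y => u (y - c) + b) = fun y => curl u (y - c) + 0 :=
    funext fun y => by rw [curl_translate_add_const, add_zero]
  rw [h, fderiv_translate_add_const]

/-- The densities of `u(· − c) + b` are the translated densities of `u`. [folklore] -/
theorem densities_translate (u : E3 → E3) (c b x : E3) :
    sig (fun y => u (y - c) + b) x = sig u (x - c) ∧ zet (fun y => u (y - c) + b) x = zet u (x - c) ∧
      pal (fun y => u (y - c) + b) x = pal u (x - c) := by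
  refine ⟨?_, ?_, ?_⟩
  · unfold sig; rw [curl_translate_add_const, fderiv_translate_add_const]
  · unfold zet; rw [curl_translate_add_const]
  · unfold pal; rw [fderiv_curl_translate_add_const]

/-- A translate vanishes near every point off its support. [folklore] -/
theorem translate_eventuallyEq_zero (u : E3 → E3) {c x : E3} (hx : x - c ∉ tsupport u) :
    (fun y => u (y - c)) =ᶠ[𝓝 x] fun _ => 0 := by
  have ho : IsOpen ((fun y : E3 => y - c) ⁻¹' (tsupport u)ᶜ) :=
    (isClosed_tsupport u).isOpen_compl.preimage (continuous_id.sub continuous_const)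
  filter_upwards [ho.mem_nhds hx] with y hy using image_eq_zero_of_notMem_tsupport hy

/-! ## Integrability of the densities of a test field -/

/-- For `f ∈ C^∞_c` the three densities are continuous, compactly supported, integrable. [folklore] -/
theorem integrable_densities (hf : ContDiff ℝ ∞ f) (hfc : HasCompactSupport f) :
    Integrable (sig f) (volume : Measure E3) ∧ Integrable (zet f) (volume : Measure E3) ∧
      Integrable (pal f) (volume : Measure E3) := by
  have hcurl : Continuous (curl f) := continuous_curl (hf.of_le (by norm_cast))
  have hD : Continuous (fderiv ℝ f) := hf.continuous_fderiv (by simp)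
  have hcs : ContDiff ℝ ∞ (curl f) := by
    rw [curl_eq_curlCLM_comp]; exact curlCLM.contDiff.comp (hf.fderiv_right (m := ∞) le_rfl)
  have hDc : Continuous (fderiv ℝ (curl f)) := hcs.continuous_fderiv (by simp)
  refine ⟨DepletionLadder.KStar.integrable_of_vanish hfc (hcurl.inner (hD.clm_apply hcurl))
      fun x hx => (densities_eq_zero_of_notMem hx).1,
    DepletionLadder.KStar.integrable_of_vanish hfc (hcurl.norm.pow 2) fun x hx => (densities_eq_zero_of_notMem hx).2.1,
    DepletionLadder.KStar.integrable_of_vanish hfc (continuous_frobeniusNormSq3.comp hDc)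
      fun x hx => (densities_eq_zero_of_notMem hx).2.2⟩

/-- A `C^∞_c` field has bounded gradient and `D⁰, D¹, D² ∈ L²`. [folklore] -/
theorem admissible_of_compactSupport (hf : ContDiff ℝ ∞ f) (hfc : HasCompactSupport f) :
    (∃ B : ℝ, ∀ x, ‖fderiv ℝ f x‖ ≤ B) ∧ (∫⁻ x, ‖iteratedFDeriv ℝ 0 f x‖ₑ ^ 2 < ⊤) ∧
      (∫⁻ x, ‖iteratedFDeriv ℝ 1 f x‖ₑ ^ 2 < ⊤) ∧ (∫⁻ x, ‖iteratedFDeriv ℝ 2 f x‖ₑ ^ 2 < ⊤) := by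
  obtain ⟨C, hC⟩ := (hf.continuous_fderiv (by simp)).bounded_above_of_compact_support (hfc.fderiv (𝕜 := ℝ))
  have hk : ∀ k : ℕ, ∫⁻ x, ‖iteratedFDeriv ℝ k f x‖ₑ ^ 2 < ⊤ := fun k =>
    DepletionLadder.KStar.lintegral_enorm_sq_lt_top_iff_eLpNorm.2
      (((hf.continuous_iteratedFDeriv (by exact_mod_cast le_top)).memLp_of_hasCompactSupport
        (hfc.iteratedFDeriv (𝕜 := ℝ) k)).2)
  exact ⟨⟨C, hC⟩, hk 0, hk 1, hk 2⟩

/-! ## The lattice of centres -/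

variable {N : ℕ}

/-- Lattice point `(k₁, k₂, k₃) ∈ ℝ³`. -/
def lat (k : Fin N × Fin N × Fin N) : E3 := WithLp.toLp 2 ![(k.1 : ℝ), (k.2.1 : ℝ), (k.2.2 : ℝ)]

/-- Centre `s · (k₁, k₂, k₃)`. -/
def centre (s : ℝ) (k : Fin N × Fin N × Fin N) : E3 := s • lat k

/-- Auxiliary (`norm_lat_sq`). [folklore] -/
theorem norm_lat_sq (k : Fin N × Fin N × Fin N) :
    ‖lat k‖ ^ 2 = (k.1 : ℝ) ^ 2 + (k.2.1 : ℝ) ^ 2 + (k.2.2 : ℝ) ^ 2 := by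
  rw [EuclideanSpace.norm_eq, Real.sq_sqrt (Finset.sum_nonneg fun i _ => sq_nonneg _), Fin.sum_univ_three]
  simp [lat]

/-- Auxiliary (`norm_lat_sub_sq`). [folklore] -/
theorem norm_lat_sub_sq (k j : Fin N × Fin N × Fin N) :
    ‖lat k - lat j‖ ^ 2 = ((k.1 : ℝ) - j.1) ^ 2 + ((k.2.1 : ℝ) - j.2.1) ^ 2 + ((k.2.2 : ℝ) - j.2.2) ^ 2 := by
  rw [EuclideanSpace.norm_eq, Real.sq_sqrt (Finset.sum_nonneg fun i _ => sq_nonneg _), Fin.sum_univ_three]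
  simp [lat]

/-- Auxiliary (`one_le_sq_sub_of_ne`): distinct naturals are `≥ 1` apart. [folklore] -/
theorem one_le_sq_sub_of_ne {a c : ℕ} (h : a ≠ c) : 1 ≤ ((a : ℝ) - c) ^ 2 := by
  rcases Nat.lt_or_gt_of_ne h with hlt | hlt
  · have h1 : (a : ℝ) + 1 ≤ c := by exact_mod_cast hlt
    nlinarith
  · have h1 : (c : ℝ) + 1 ≤ a := by exact_mod_cast hlt
    nlinarith

/-- Distinct lattice points are at distance `≥ 1`. [folklore] -/
theorem one_le_norm_lat_sub {k j : Fin N × Fin N × Fin N} (h : k ≠ j) : 1 ≤ ‖lat k - lat j‖ := by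
  have hsq : 1 ≤ ‖lat k - lat j‖ ^ 2 := by
    rw [norm_lat_sub_sq]
    have h0 := sq_nonneg ((k.1 : ℝ) - j.1)
    have h1 := sq_nonneg ((k.2.1 : ℝ) - j.2.1)
    have h2 := sq_nonneg ((k.2.2 : ℝ) - j.2.2)
    by_cases e1 : k.1 = j.1
    · by_cases e2 : k.2.1 = j.2.1
      · have e3 : k.2.2 ≠ j.2.2 := fun e3 => h (Prod.ext e1 (Prod.ext e2 e3))
        have := one_le_sq_sub_of_ne (Fin.val_ne_of_ne e3)
        linarith
      · have := one_le_sq_sub_of_ne (Fin.val_ne_of_ne e2)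
        linarith
    · have := one_le_sq_sub_of_ne (Fin.val_ne_of_ne e1)
      linarith
  nlinarith [norm_nonneg (lat k - lat j)]

/-- Lattice points of the `N`-cube have norm `≤ 2N`. [folklore] -/
theorem norm_lat_le (k : Fin N × Fin N × Fin N) : ‖lat k‖ ≤ 2 * N := by
  have h1 : (k.1 : ℝ) ≤ N := by exact_mod_cast k.1.2.le
  have h2 : (k.2.1 : ℝ) ≤ N := by exact_mod_cast k.2.1.2.le
  have h3 : (k.2.2 : ℝ) ≤ N := by exact_mod_cast k.2.2.2.le
  have h1' : (0:ℝ) ≤ k.1 := Nat.cast_nonneg _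
  have h2' : (0:ℝ) ≤ k.2.1 := Nat.cast_nonneg _
  have h3' : (0:ℝ) ≤ k.2.2 := Nat.cast_nonneg _
  have hsq : ‖lat k‖ ^ 2 ≤ (2 * N) ^ 2 := by rw [norm_lat_sq]; nlinarith
  exact (pow_le_pow_iff_left₀ (norm_nonneg _) (by positivity) two_ne_zero).1 hsq

/-- Distinct centres are `≥ s` apart. [folklore] -/
theorem le_norm_centre_sub {s : ℝ} (hs : 0 ≤ s) {k j : Fin N × Fin N × Fin N} (h : k ≠ j) :
    s ≤ ‖centre s k - centre s j‖ := by
  unfold centre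
  rw [← smul_sub, norm_smul, Real.norm_eq_abs, abs_of_nonneg hs]
  nlinarith [one_le_norm_lat_sub h]

/-- Centres have norm `≤ 2sN`. [folklore] -/
theorem norm_centre_le {s : ℝ} (hs : 0 ≤ s) (k : Fin N × Fin N × Fin N) : ‖centre s k‖ ≤ 2 * s * N := by
  unfold centre
  rw [norm_smul, Real.norm_eq_abs, abs_of_nonneg hs]
  nlinarith [norm_lat_le k]

end ExtremiserLiouville

end Summit.NavierStokesRegularity.NavierStokesRegularity.Theorems

end
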